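import Literature.MathematicalPhysics.StatisticalMechanics.NJLTwoPointThermodynamicLimit
import HarnessLib

/-!
# Analyticity in a strip of the lattice Fourier transform of an exponentially decaying function, and
# Salmhofer–Seiler's Theorem 3.23 (2) "`ĝ` is analytic for `|Im k_μ| < κ(m)`" (CMP 139 (1991), (3.111))

Companion of `NJLTwoPointThermodynamicLimit` (Thm. 3.23 (2) in lattice form: for the NJL model at
real `m > 0` every thermodynamic limit of the two-point function is `T = s² + g` with
`|g(x)| ≤ C e^{-κ|x_μ|}`).  Salmhofer–Seiler's printed conclusion is that "`ĝ` is analytic for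
`|Im k_μ| < κ(m)`" ((3.111) and proof p. 417: "`g(x)` clusters exponentially for `m ≠ 0`, therefore
its Fourier transform `ĝ` is analytic in `k` for `|Im k_μ| < κ(m)`").  This file proves that
Paley–Wiener-type step and the literal statement:

* (private) `summable_exp_neg_mul_sum_abs` — `∑_{x ∈ ℤ^ν} e^{-c∑_μ|x_μ|} < ∞` (`c > 0`; product of
  geometric series);
* **`differentiableOn_latFourier_of_decay`** — if `|g(x)| ≤ C e^{-a∑_μ|x_μ|}`, `a > 0`, the lattice
  Fourier series `ĝ(k) = ∑_x g(x) e^{-ik·x}` (`latFourier`) is complex (Fréchet-)differentiable on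
  the strip `{k ∈ ℂ^ν : |Im k_μ| < a}` (`momentumStrip`), by termwise differentiation of a normally
  convergent series of entire functions (Mathlib's `hasFDerivAt_tsum_of_isPreconnected` on the
  smaller strips `|Im k_μ| < b < a`, with the majorant `C (2/(a-b)) e^{-((a-b)/2)∑|x_μ|}`);
* **`njl_twoPoint_thermodynamicLimit_analyticStrip`** — Thm. 3.23 (2): for the NJL system, `ν ≥ 3`,
  real `m > 0`, along even tori `Λ_n → ∞`: `T_{Λ_n} → T`, `⟨σ_x⟩_{Λ_n} → s`, atoms `c₀ = s²`,
  `c_π̂ = 0`, and `ĝ`, `g = T - s²`, is holomorphic on `|Im k_μ| < κ'(m)` for some `κ' > 0`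
  (here `κ' = κ/ν`, `κ` the rate of Thm. 3.11 in the limit; the print does not specify `κ(m)`).

Honest framing: `β = 0` NJL complex spin systems and their pointwise thermodynamic limits; nothing
about `β > 0`, the continuum, `SU(N)` or the summit's `QCD` conjunct.

## References

* M. Salmhofer, E. Seiler, *Proof of chiral symmetry breaking in strongly coupled lattice gauge
  theory*, Commun. Math. Phys. 139 (1991) 395–432: Thm. 3.23 (2) (3.111) and proof p. 417.
  [SalmhoferSeiler1991]

## Mathlib

`hasFDerivAt_tsum_of_isPreconnected` (termwise differentiation), `summable_int_iff_summable_nat_and_neg`,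
`summable_geometric_of_lt_one`, `Fin.consEquiv` (product trick), `convex_pi`, `Convex.isPreconnected`.
-/

noncomputable section

namespace Literature.MathematicalPhysics.StatisticalMechanics

namespace ComplexSpin

open MvPolynomial Finset Filter Topology Complex
open Literature.Probability.LatticeModels

variable {ν : ℕ}

/-! ### Summability of `e^{-c ∑_μ |x_μ|}` on `ℤ^ν` (product trick) -/

/-- `∑_{n ∈ ℤ} e^{-c|n|} < ∞` for `c > 0`. [folklore] -/
private theorem summable_exp_neg_mul_abs_int {c : ℝ} (hc : 0 < c) :
    Summable fun n : ℤ => Real.exp (-c * |(n : ℝ)|) := by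
  have hr0 : 0 ≤ Real.exp (-c) := (Real.exp_pos _).le
  have hr1 : Real.exp (-c) < 1 := Real.exp_lt_one_iff.2 (by linarith)
  have hgeo := summable_geometric_of_lt_one hr0 hr1
  have hnat : ∀ n : ℕ, Real.exp (-c * (n : ℝ)) = Real.exp (-c) ^ n := fun n => by
    rw [← Real.exp_nat_mul]; ring_nf
  rw [summable_int_iff_summable_nat_and_neg]
  constructor
  · refine hgeo.congr fun n => ?_
    rw [Int.cast_natCast, abs_of_nonneg (Nat.cast_nonneg n), hnat]
  · refine hgeo.congr fun n => ?_
    rw [Int.cast_neg, Int.cast_natCast, abs_neg, abs_of_nonneg (Nat.cast_nonneg n), hnat]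

/-- **`∑_{x ∈ ℤ^ν} e^{-c ∑_μ |x_μ|} < ∞`** for `c > 0` (the product of `ν` geometric series). [folklore] -/
private theorem summable_exp_neg_mul_sum_abs {c : ℝ} (hc : 0 < c) :
    ∀ ν : ℕ, Summable fun x : Site ν => Real.exp (-c * ∑ i, |(x i : ℝ)|) := by
  intro ν
  induction ν with
  | zero => exact .of_finite
  | succ n ih =>
    have hprod := (summable_exp_neg_mul_abs_int hc).mul_of_nonneg ih
      (fun _ => (Real.exp_pos _).le) (fun _ => (Real.exp_pos _).le)
    have h := (Equiv.summable_iff (f := fun x : Site (n + 1) => Real.exp (-c * ∑ i, |(x i : ℝ)|))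
      (Fin.consEquiv fun _ : Fin (n + 1) => ℤ)).1
    apply h
    refine hprod.congr fun p => ?_
    show Real.exp (-c * |(p.1 : ℝ)|) * Real.exp (-c * ∑ i, |(p.2 i : ℝ)|) =
      Real.exp (-c * ∑ i, |((Fin.cons p.1 p.2 : Fin (n + 1) → ℤ) i : ℝ)|)
    rw [← Real.exp_add, Fin.sum_univ_succ, Fin.cons_zero]
    simp only [Fin.cons_succ]
    ring_nf

/-! ### The lattice Fourier series on a complex strip -/

/-- The lattice Fourier series `ĝ(k) = ∑_{x ∈ ℤ^ν} g(x) e^{-ik·x}` at COMPLEX momenta `k ∈ ℂ^ν`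
(the Fourier transform of the regular part `g(x) = ⟨σ₀σ_x⟩ - ⟨σ₀⟩⟨σ_x⟩` in Thm. 3.23 (2)).
[cite: SalmhoferSeiler1991, Thm. 3.23 (2) (3.111)] -/
def latFourier (g : Site ν → ℝ) (k : Fin ν → ℂ) : ℂ :=
  ∑' x : Site ν, (g x : ℂ) * Complex.exp (-(I * ∑ μ, (x μ : ℂ) * k μ))

/-- The strip `{k ∈ ℂ^ν : |Im k_μ| < b for all μ}`. [cite: SalmhoferSeiler1991, Thm. 3.23 (2)] -/
def momentumStrip (ν : ℕ) (b : ℝ) : Set (Fin ν → ℂ) := {k | ∀ μ, |(k μ).im| < b}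

/-- The strip is open. [cite: SalmhoferSeiler1991, Thm. 3.23 (2)] -/
theorem isOpen_momentumStrip (b : ℝ) : IsOpen (momentumStrip ν b) := by
  have : momentumStrip ν b = ⋂ μ, {k : Fin ν → ℂ | |(k μ).im| < b} := by
    ext k; simp [momentumStrip]
  rw [this]
  exact isOpen_iInter_of_finite fun μ =>
    isOpen_lt (continuous_abs.comp (Complex.continuous_im.comp (continuous_apply μ))) continuous_const

/-- The strip is a product of convex strips, hence convex and preconnected.
[cite: SalmhoferSeiler1991, Thm. 3.23 (2)] -/
theorem isPreconnected_momentumStrip (b : ℝ) : IsPreconnected (momentumStrip ν b) := by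
  have h : momentumStrip ν b = Set.pi Set.univ fun _ : Fin ν => Complex.imLm ⁻¹' Set.Ioo (-b) b := by
    ext k
    simp [momentumStrip, abs_lt]
  rw [h]
  exact (convex_pi fun μ _ => (convex_Ioo (-b) b).linear_preimage Complex.imLm).isPreconnected

/-- The phase `k ↦ x·k = ∑_μ x_μ k_μ` as a continuous linear form on `ℂ^ν`. [folklore] -/
private def phaseCLM (x : Site ν) : (Fin ν → ℂ) →L[ℂ] ℂ :=
  ∑ μ : Fin ν, (x μ : ℂ) • ContinuousLinearMap.proj μ

/-- Evaluation of the phase form. [folklore] -/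
private theorem phaseCLM_apply (x : Site ν) (k : Fin ν → ℂ) :
    phaseCLM x k = ∑ μ, (x μ : ℂ) * k μ := by
  simp [phaseCLM]

/-- `‖x·‖ ≤ ∑_μ |x_μ|` (sup norm on `ℂ^ν`). [folklore] -/
private theorem norm_phaseCLM_le (x : Site ν) : ‖phaseCLM x‖ ≤ ∑ μ, |(x μ : ℝ)| := by
  refine ContinuousLinearMap.opNorm_le_bound _ (Finset.sum_nonneg fun μ _ => abs_nonneg _) fun k => ?_
  rw [phaseCLM_apply, Finset.sum_mul]
  refine (norm_sum_le _ _).trans (Finset.sum_le_sum fun μ _ => ?_)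
  rw [norm_mul, Complex.norm_intCast]
  exact mul_le_mul_of_nonneg_left (norm_le_pi_norm k μ) (abs_nonneg _)

/-- `Re(-i x·k) = ∑_μ x_μ Im k_μ ≤ b ∑_μ |x_μ|` on the strip. [folklore] -/
private theorem re_phase_le {b : ℝ} {k : Fin ν → ℂ} (hk : k ∈ momentumStrip ν b) (x : Site ν) :
    (-(I * ∑ μ, (x μ : ℂ) * k μ)).re ≤ b * ∑ μ, |(x μ : ℝ)| := by
  rw [Complex.neg_re, Complex.mul_re, Complex.I_re, Complex.I_im, zero_mul, one_mul, zero_sub, neg_neg,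
    Complex.im_sum, Finset.mul_sum]
  refine Finset.sum_le_sum fun μ _ => ?_
  rw [Complex.mul_im, Complex.intCast_re, Complex.intCast_im, zero_mul, add_zero]
  have h := (abs_lt.1 (hk μ))
  have : (x μ : ℝ) * (k μ).im ≤ |(x μ : ℝ)| * b := by
    rcases le_or_gt 0 (x μ : ℝ) with hx | hx
    · rw [abs_of_nonneg hx]; nlinarith
    · rw [abs_of_neg hx]; nlinarith
  linarith

/-- The summand `g(x) e^{-ik·x}` and its derivative in `k`. [folklore] -/
private theorem hasFDerivAt_term (g : Site ν → ℝ) (x : Site ν) (k : Fin ν → ℂ) :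
    HasFDerivAt (fun k : Fin ν → ℂ => (g x : ℂ) * Complex.exp (-(I * ∑ μ, (x μ : ℂ) * k μ)))
      ((g x : ℂ) • (Complex.exp (-(I * ∑ μ, (x μ : ℂ) * k μ)) • ((-I) • phaseCLM x))) k := by
  have h1 : HasFDerivAt (fun k : Fin ν → ℂ => -(I * ∑ μ, (x μ : ℂ) * k μ)) ((-I) • phaseCLM x) k := by
    refine (((-I) • phaseCLM x).hasFDerivAt (x := k)).congr_of_eventuallyEq ?_
    exact Filter.Eventually.of_forall fun k' => by
      simp only [FunLike.coe_smul, Pi.smul_apply, phaseCLM_apply, smul_eq_mul]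
      ring
  have h2 := (Complex.hasDerivAt_exp _).comp_hasFDerivAt k h1
  have h3 := h2.const_mul (g x : ℂ)
  simp only [Function.comp_def] at h3
  exact h3

/-- Bound on the derivative of the summand on the strip `|Im k_μ| < b`:
`‖D_k (g(x)e^{-ik·x})‖ ≤ |g(x)| e^{b∑|x_μ|} ∑|x_μ|`. [folklore] -/
private theorem norm_fderiv_term_le (g : Site ν → ℝ) (x : Site ν) {b : ℝ} {k : Fin ν → ℂ}
    (hk : k ∈ momentumStrip ν b) :
    ‖(g x : ℂ) • (Complex.exp (-(I * ∑ μ, (x μ : ℂ) * k μ)) • ((-I) • phaseCLM x))‖ ≤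
      |g x| * Real.exp (b * ∑ μ, |(x μ : ℝ)|) * ∑ μ, |(x μ : ℝ)| := by
  rw [norm_smul, norm_smul, norm_smul, norm_neg, Complex.norm_I, one_mul, Complex.norm_real,
    Real.norm_eq_abs, Complex.norm_exp]
  have h1 : Real.exp (-(I * ∑ μ, (x μ : ℂ) * k μ)).re ≤ Real.exp (b * ∑ μ, |(x μ : ℝ)|) :=
    Real.exp_le_exp.2 (re_phase_le hk x)
  have h2 := norm_phaseCLM_le x
  calc |g x| * (Real.exp (-(I * ∑ μ, (x μ : ℂ) * k μ)).re * ‖phaseCLM x‖)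
      ≤ |g x| * (Real.exp (b * ∑ μ, |(x μ : ℝ)|) * ∑ μ, |(x μ : ℝ)|) :=
        mul_le_mul_of_nonneg_left (mul_le_mul h1 h2 (norm_nonneg _) (Real.exp_pos _).le) (abs_nonneg _)
    _ = |g x| * Real.exp (b * ∑ μ, |(x μ : ℝ)|) * ∑ μ, |(x μ : ℝ)| := by ring

/-- `t ≤ (2/c) e^{(c/2) t}` for `c > 0`. [folklore] -/
private theorem le_mul_exp_half {c : ℝ} (hc : 0 < c) (t : ℝ) : t ≤ 2 / c * Real.exp (c / 2 * t) := by
  have h := Real.add_one_le_exp (c / 2 * t)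
  have h2 : c / 2 * t ≤ Real.exp (c / 2 * t) := by linarith
  calc t = 2 / c * (c / 2 * t) := by field_simp
    _ ≤ 2 / c * Real.exp (c / 2 * t) := mul_le_mul_of_nonneg_left h2 (by positivity)

/-- **The lattice Fourier series of an exponentially decaying function is holomorphic in a strip**:
if `|g(x)| ≤ C e^{-a ∑_μ|x_μ|}` with `a > 0` then `ĝ(k) = ∑_x g(x)e^{-ik·x}` is (Fréchet-)complex
differentiable on `{|Im k_μ| < a}` (termwise differentiation of a normally convergent series of
holomorphic functions). [cite: SalmhoferSeiler1991, Thm. 3.23 (2) (proof, p. 417)] -/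
theorem differentiableOn_latFourier_of_decay {g : Site ν → ℝ} {C a : ℝ} (ha : 0 < a)
    (hg : ∀ x, |g x| ≤ C * Real.exp (-a * ∑ μ, |(x μ : ℝ)|)) :
    DifferentiableOn ℂ (latFourier g) (momentumStrip ν a) := by
  intro k hk
  -- a smaller strip `b < a` containing `k`
  obtain ⟨b, hkb, hba⟩ : ∃ b, k ∈ momentumStrip ν b ∧ b < a := by
    rcases Nat.eq_zero_or_pos ν with hν | hν
    · subst hν
      exact ⟨a / 2, fun μ => Fin.elim0 μ, by linarith⟩
    · obtain ⟨μ₀, -, hμ₀⟩ := Finset.exists_max_image (Finset.univ : Finset (Fin ν))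
        (fun μ => |(k μ).im|) ⟨⟨0, hν⟩, Finset.mem_univ _⟩
      refine ⟨(|(k μ₀).im| + a) / 2, fun μ => ?_, by linarith [hk μ₀]⟩
      have := hμ₀ μ (Finset.mem_univ μ)
      linarith [hk μ₀]
  have hC : 0 ≤ C := by
    have := (abs_nonneg (g 0)).trans (hg 0)
    simp at this
    exact this
  have hab : 0 < a - b := by linarith
  -- the summable majorant of the derivatives on the strip `b`
  set c : ℝ := (a - b) / 2 with hc
  have hcpos : 0 < c := by positivity
  set u : Site ν → ℝ := fun x => C * (2 / (a - b)) * Real.exp (-c * ∑ μ, |(x μ : ℝ)|) with hu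
  have hu_sum : Summable u := (summable_exp_neg_mul_sum_abs hcpos ν).mul_left _
  have hbound : ∀ x, ∀ k' ∈ momentumStrip ν b,
      ‖(g x : ℂ) • (Complex.exp (-(I * ∑ μ, (x μ : ℂ) * k' μ)) • ((-I) • phaseCLM x))‖ ≤ u x := by
    intro x k' hk'
    refine (norm_fderiv_term_le g x hk').trans ?_
    set t : ℝ := ∑ μ, |(x μ : ℝ)| with ht
    have ht0 : 0 ≤ t := Finset.sum_nonneg fun μ _ => abs_nonneg _
    have h1 : t ≤ 2 / (a - b) * Real.exp ((a - b) / 2 * t) := le_mul_exp_half hab t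
    calc |g x| * Real.exp (b * t) * t
        ≤ (C * Real.exp (-a * t)) * Real.exp (b * t) * (2 / (a - b) * Real.exp ((a - b) / 2 * t)) := by
          gcongr
          exact hg x
      _ = u x := by
          rw [hu, hc]
          simp only
          rw [show C * Real.exp (-a * t) * Real.exp (b * t) * (2 / (a - b) * Real.exp ((a - b) / 2 * t)) =
            C * (2 / (a - b)) * (Real.exp (-a * t) * Real.exp (b * t) * Real.exp ((a - b) / 2 * t)) by ring,
            ← Real.exp_add, ← Real.exp_add]
          congr 2
          ring
  -- summability at the point `0` of the strip
  have h0mem : (0 : Fin ν → ℂ) ∈ momentumStrip ν b := fun μ => by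
    simp only [Pi.zero_apply, Complex.zero_im, abs_zero]
    have := hk μ; have := abs_nonneg ((k μ).im); linarith [hkb μ]
  have hsum0 : Summable fun x : Site ν => (g x : ℂ) * Complex.exp (-(I * ∑ μ, (x μ : ℂ) * (0 : Fin ν → ℂ) μ)) := by
    refine Summable.of_norm_bounded ((summable_exp_neg_mul_sum_abs ha ν).mul_left C) fun x => ?_
    simp only [Pi.zero_apply, mul_zero, Finset.sum_const_zero, mul_zero, neg_zero, Complex.exp_zero,
      mul_one, Complex.norm_real, Real.norm_eq_abs]
    exact hg x
  have hderiv := hasFDerivAt_tsum_of_isPreconnected hu_sum (isOpen_momentumStrip b)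
    (isPreconnected_momentumStrip b) (fun x k' _ => hasFDerivAt_term g x k') hbound h0mem hsum0 hkb
  exact hderiv.differentiableAt.differentiableWithinAt

/-- From coordinatewise exponential decay to joint decay: if `|g(x)| ≤ C e^{-κ|x_μ|}` for every
coordinate `x_μ ≠ 0`, then `|g(x)| ≤ max(C, |g 0|) e^{-(κ/ν)∑_μ|x_μ|}` (`ν ≥ 1`). [folklore] -/
private theorem decay_sum_of_decay_coord (hν : 1 ≤ ν) {g : Site ν → ℝ} {C κ : ℝ} (hκ : 0 ≤ κ)
    (hg : ∀ (x : Site ν) (μ : Fin ν), x μ ≠ 0 → |g x| ≤ C * Real.exp (-κ * |(x μ : ℝ)|)) (x : Site ν) :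
    |g x| ≤ max C |g 0| * Real.exp (-(κ / ν) * ∑ μ, |(x μ : ℝ)|) := by
  have hνpos : (0 : ℝ) < ν := by exact_mod_cast hν
  by_cases hx : x = 0
  · subst hx
    simp only [Pi.zero_apply, Int.cast_zero, abs_zero, Finset.sum_const_zero, mul_zero, Real.exp_zero,
      mul_one]
    exact le_max_right _ _
  · obtain ⟨μ₀, -, hμ₀⟩ := Finset.exists_max_image (Finset.univ : Finset (Fin ν))
      (fun μ => |(x μ : ℝ)|) ⟨⟨0, hν⟩, Finset.mem_univ _⟩
    have hx0 : x μ₀ ≠ 0 := by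
      intro h0
      apply hx
      funext μ
      have := hμ₀ μ (Finset.mem_univ μ)
      rw [h0, Int.cast_zero, abs_zero] at this
      have : |(x μ : ℝ)| = 0 := le_antisymm this (abs_nonneg _)
      exact_mod_cast abs_eq_zero.1 this
    have h1 := hg x μ₀ hx0
    have hsum : ∑ μ, |(x μ : ℝ)| ≤ ν * |(x μ₀ : ℝ)| := by
      calc ∑ μ, |(x μ : ℝ)| ≤ ∑ _μ : Fin ν, |(x μ₀ : ℝ)| :=
            Finset.sum_le_sum fun μ hμ => hμ₀ μ hμ
        _ = ν * |(x μ₀ : ℝ)| := by simp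
    have hC : 0 ≤ C := by
      by_contra hC
      have := mul_neg_of_neg_of_pos (not_le.1 hC) (Real.exp_pos (-κ * |(x μ₀ : ℝ)|))
      linarith [abs_nonneg (g x)]
    calc |g x| ≤ C * Real.exp (-κ * |(x μ₀ : ℝ)|) := h1
      _ ≤ max C |g 0| * Real.exp (-(κ / ν) * ∑ μ, |(x μ : ℝ)|) := by
          refine mul_le_mul (le_max_left _ _) (Real.exp_le_exp.2 ?_) (Real.exp_pos _).le
            (hC.trans (le_max_left _ _))
          have : κ / ν * ∑ μ, |(x μ : ℝ)| ≤ κ * |(x μ₀ : ℝ)| := by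
            calc κ / ν * ∑ μ, |(x μ : ℝ)| ≤ κ / ν * (ν * |(x μ₀ : ℝ)|) :=
                  mul_le_mul_of_nonneg_left hsum (by positivity)
              _ = κ * |(x μ₀ : ℝ)| := by field_simp
          linarith

/-- **Theorem 3.23 (2), with the strip analyticity**: for the NJL system (`N ≥ 1`), `ν ≥ 3`, real
`m > 0` and even tori `Λ_n → ∞`, the two-point function and the condensate converge,
`T_{Λ_n}(x) → T(x)`, `⟨σ_x⟩_{Λ_n} → s`, the atoms are `c₀ = s²`, `c_π̂ = 0` ("`T̂ = s²δ + ĝ`"), and the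
lattice Fourier series `ĝ(k) = ∑_x g(x)e^{-ik·x}` of `g = T - s²` is holomorphic in the strip
`|Im k_μ| < κ'` for some `κ' = κ'(m) > 0` ("`ĝ` is analytic for `|Im k_μ| < κ(m)`"; here
`κ' = κ/ν` with `κ` the clustering rate of Thm. 3.11 in the limit). [cite: SalmhoferSeiler1991, Thm. 3.23 (2) (3.111)] -/
theorem njl_twoPoint_thermodynamicLimit_analyticStrip {N : ℕ} (hN : 1 ≤ N) (hν : 3 ≤ ν) {m : ℝ}
    (hm : 0 < m) (Ls : ℕ → ℕ) [∀ n, NeZero (Ls n)] (hev : ∀ n, Even (Ls n))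
    (hLs : Tendsto Ls atTop atTop) :
    ∃ T : Site ν → ℝ, ∃ s : ℝ,
      (∀ x, Tendsto (fun n => corrFn (L := Ls n) N m (njlBondCoeff N) (Torus.proj (Ls n) x))
        atTop (nhds (T x))) ∧
      (∀ x : Site ν, Tendsto (fun n => expect (L := Ls n) N m (njlBondCoeff N)
        (X (Torus.proj (Ls n) x))) atTop (nhds s)) ∧
      Tendsto (fun n => zeroMode (ν := ν) (L := Ls n) N m (njlBondCoeff N)) atTop (nhds (s ^ 2)) ∧
      Tendsto (fun n => stagMode (ν := ν) (L := Ls n) (hev n).two_dvd N m (njlBondCoeff N))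
        atTop (nhds 0) ∧
      ∃ κ' : ℝ, 0 < κ' ∧ DifferentiableOn ℂ (latFourier fun x => T x - s ^ 2) (momentumStrip ν κ') := by
  have hν1 : 1 ≤ ν := by omega
  have hνpos : (0 : ℝ) < ν := by exact_mod_cast hν1
  obtain ⟨T, s, hT, hS, hc, hc', ⟨κ, hκ, C, hC, hdecay⟩, -⟩ :=
    njl_twoPoint_thermodynamicLimit hN hν hm Ls hev hLs
  refine ⟨T, s, hT, hS, hc, hc', κ / ν, by positivity, ?_⟩
  exact differentiableOn_latFourier_of_decay (C := max C |T 0 - s ^ 2|) (by positivity)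
    (decay_sum_of_decay_coord hν1 hκ.le hdecay)

end ComplexSpin

end Literature.MathematicalPhysics.StatisticalMechanics

end
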